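import Mathlib

/-!
# LitKType — the joint-harmonics K-type correspondence for real unitary dual pairs, as printed

Blind cell `pub-hodge-repro`, seat lit-2 (gen 4).  The archimedean K-type bookkeeping of ROUTE-B §9.7 /
ROUTE.md §4 item 2 (9) / SOURCES.md row KK1 (the printed origin of the sealed (b) slot magnitudes),
typed from the clean TeX source and kernel-checked in its finite instances.

**Source (verbatim; SOURCES.md row «lit-2 batch 8»).**  Ichino, *Theta lifting for discrete series
representations of real unitary groups*, arXiv:2002.09148 (store `paper:arxiv-2002.09148`), Lemma 7.8
(p0024:L66–L92) = *Theta lifting for tempered representations of real unitary groups*, arXiv:2008.06174,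
Adv. Math. (2022) (store `paper:arxiv-2008.06174`), Lemma 7.10 (p0020:L9–L33).  Setting (p0008:L7–L31):
"W is an n-dimensional skew-Hermitian space over ℂ and V is an m-dimensional Hermitian space over ℂ.
Let (p,q) and (r,s) be the signatures of W and V, respectively, so that p+q = n and r+s = m. …
χ_V(z) = (z/√(z z̄))^{m_0}, χ_W(z) = (z/√(z z̄))^{n_0} with some fixed integers m_0, n_0 such that
m_0 ≡ m mod 2, n_0 ≡ n mod 2, and the character ψ of ℝ given by ψ(x) = e^{−2π√−1 x}."  K-types
(p0024:L43–L56): "we … parametrize the irreducible representations of K [≅ U(p) × U(q) ⊂ U(W)] by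
highest weights (a_1, …, a_p; b_1, …, b_q), where a_i, b_j ∈ ℤ; a_1 ≥ ⋯ ≥ a_p and b_1 ≥ ⋯ ≥ b_q", and
similarly for K′ ≅ U(r) × U(s) ⊂ U(V).  "Let ℋ be the space of joint harmonics … we say that μ and μ′
correspond if μ ⊠ μ′ occurs in ℋ, in which case μ and μ′ determine each other."

**Lemma 7.8.** "Let μ and μ′ be irreducible representations of K and K′, respectively. Then μ and μ′
correspond if and only if μ and μ′ are of the form
μ = (a_1, …, a_x, 0, …, 0, b_1, …, b_y; c_1, …, c_z, 0, …, 0, d_1, …, d_w)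
    + ((r−s)/2, …, (r−s)/2; (s−r)/2, …, (s−r)/2) + (m_0/2, …, m_0/2)
and
μ′ = (a_1, …, a_x, 0, …, 0, d_1, …, d_w; c_1, …, c_z, 0, …, 0, b_1, …, b_y)
    + ((p−q)/2, …, (p−q)/2; (q−p)/2, …, (q−p)/2) + (n_0/2, …, n_0/2),
where a_i, b_j, c_k, d_l ∈ ℤ; a_1 ≥ ⋯ ≥ a_x > 0 > b_1 ≥ ⋯ ≥ b_y and c_1 ≥ ⋯ ≥ c_z > 0 > d_1 ≥ ⋯ ≥ d_w;
x+y ≤ p and z+w ≤ q; x+w ≤ r and z+y ≤ s."  Proof as printed (p0024:L93–L97): "Given our choice of the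
data (χ_V, χ_W, ψ), the assertion follows from [konno]. We remark that the convention in [konno] is
different from ours (see [konno] and [gi2]). In particular, to switch the left and right actions of
U(W) on W, we need to compose the Weil representation ω_{V,W,ξ} as in [konno] relative to the pair
ξ = (χ_W, χ_V^{−1}) with the automorphism g ↦ ᵗg^{−1} of U(p,q)."  ([konno] = Konno–Konno, Kyushu J.
Math. 61 (2007), Lemma 5.3, SOURCES.md row KK1 — whose display is OCR-scrambled in the store.)

**What is typed.**  Mathlib has no Fock model / joint harmonics, so "μ and μ′ correspond" is NOT
typed; typed is the right-hand side — the combinatorial relation «μ and μ′ are of the printed form»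
(`Correspond`), verbatim, with the standing parities m_0 ≡ r + s, n_0 ≡ p + q as conjuncts — and its
finite instances are PROVED: the vacuum pairs for every signature (`correspond_vacuum`); the complete
list of pairs when W is a LINE (`correspond_posLine_iff`, `correspond_negLine_iff`); against the
definite plane U(2) a line's character meets a CHARACTER of U(2) only at the vacuum, of type
det^{(n_0 ± 1)/2}, + iff the line is positive, and against signature (r, s) the vacuum weights of a
positive and a negative line differ by exactly r − s (3 for (3,0), 1 for (2,1) — the sealed (b) slot
magnitudes, row KK1): these corollaries are in the companion file `LitKTypeLine.lean`.  No new named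
fact (D-0026): one definition, all theorems proved; the representation-theoretic half is the printed
lemma, cited, not re-proved.
-/

namespace HodgeRepro.Lit2.KType

/-- `a₁ ≥ ⋯ ≥ a_x > 0`: an antitone list of strictly positive integers (IC1 Lemma 7.8, the `a`/`c` blocks). -/
def PosAntitone (a : List ℤ) : Prop := a.Pairwise (· ≥ ·) ∧ ∀ t ∈ a, 0 < t

/-- `0 > b₁ ≥ ⋯ ≥ b_y`: an antitone list of strictly negative integers (IC1 Lemma 7.8, the `b`/`d` blocks). -/
def NegAntitone (b : List ℤ) : Prop := b.Pairwise (· ≥ ·) ∧ ∀ t ∈ b, t < 0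

/-- The printed block `(a₁, …, a_x, 0, …, 0, b₁, …, b_y) + (t, …, t)` of length `n`
(meaningful when `a.length + b.length ≤ n`): the positive block, zeros, the negative block, every
entry shifted by the constant `t`. -/
def padded (a b : List ℤ) (n : ℕ) (t : ℤ) : List ℤ :=
  (a ++ List.replicate (n - a.length - b.length) 0 ++ b).map (· + t)

/-- **IC1 Lemma 7.8 (p0024:L66–L92), the printed relation «μ and μ′ are of the form …».**
`W` skew-hermitian of signature `(p, q)`, `V` hermitian of signature `(r, s)`, splitting exponents
`m₀ ≡ r + s`, `n₀ ≡ p + q (mod 2)` (p0008:L11–L22); `μ = (μ.1; μ.2)` a highest weight of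
`U(p) × U(q)`, `μ' = (μ'.1; μ'.2)` one of `U(r) × U(s)`, as lists.  The four blocks `a, b, c, d` and the
constraints `x+y ≤ p, z+w ≤ q, x+w ≤ r, z+y ≤ s` are the printed ones; the constant shifts are
`(r−s)/2 + m₀/2` on the `U(p)` block, `(s−r)/2 + m₀/2` on `U(q)`, `(p−q)/2 + n₀/2` on `U(r)`,
`(q−p)/2 + n₀/2` on `U(s)` (integers by the parities; `Int` division is exact there). -/
def Correspond (p q r s : ℕ) (m₀ n₀ : ℤ) (μ μ' : List ℤ × List ℤ) : Prop :=
  ((r : ℤ) + s + m₀) % 2 = 0 ∧ ((p : ℤ) + q + n₀) % 2 = 0 ∧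
  ∃ a b c d : List ℤ, PosAntitone a ∧ NegAntitone b ∧ PosAntitone c ∧ NegAntitone d ∧
    a.length + b.length ≤ p ∧ c.length + d.length ≤ q ∧
    a.length + d.length ≤ r ∧ c.length + b.length ≤ s ∧
    μ.1 = padded a b p (((r : ℤ) - s + m₀) / 2) ∧ μ.2 = padded c d q (((s : ℤ) - r + m₀) / 2) ∧
    μ'.1 = padded a d r (((p : ℤ) - q + n₀) / 2) ∧ μ'.2 = padded c b s (((q : ℤ) - p + n₀) / 2)

/-! ### Elementary facts about the blocks -/

/-- The empty block is a (vacuous) positive block. -/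
@[simp] lemma posAntitone_nil : PosAntitone [] := by simp [PosAntitone]

/-- The empty block is a (vacuous) negative block. -/
@[simp] lemma negAntitone_nil : NegAntitone [] := by simp [NegAntitone]

/-- A singleton is a positive block iff its entry is positive. -/
@[simp] lemma posAntitone_singleton (a : ℤ) : PosAntitone [a] ↔ 0 < a := by simp [PosAntitone]

/-- A singleton is a negative block iff its entry is negative. -/
@[simp] lemma negAntitone_singleton (b : ℤ) : NegAntitone [b] ↔ b < 0 := by simp [NegAntitone]

/-- `padded [] [] n t = (t, …, t)`: the vacuum block. -/
@[simp] lemma padded_nil_nil (n : ℕ) (t : ℤ) : padded [] [] n t = List.replicate n t := by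
  simp [padded]

/-- `padded [a] [] n t = (a + t, t, …, t)` for `1 ≤ n`. -/
lemma padded_singleton_nil (a : ℤ) (n : ℕ) (t : ℤ) (_hn : 1 ≤ n) :
    padded [a] [] n t = (a + t) :: List.replicate (n - 1) t := by
  simp [padded]

/-- `padded [] [b] n t = (t, …, t, b + t)` for `1 ≤ n`. -/
lemma padded_nil_singleton (b : ℤ) (n : ℕ) (t : ℤ) (_hn : 1 ≤ n) :
    padded [] [b] n t = List.replicate (n - 1) t ++ [b + t] := by
  simp [padded]

/-- Length bookkeeping: a list of length ≤ 1 is `[]` or a singleton. -/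
lemma eq_nil_or_singleton_of_length_le_one {l : List ℤ} (h : l.length ≤ 1) :
    l = [] ∨ ∃ x, l = [x] := by
  rcases l with _ | ⟨x, _ | ⟨y, l⟩⟩
  · exact Or.inl rfl
  · exact Or.inr ⟨x, rfl⟩
  · simp at h

/-- The `U(V)`-side shift of a POSITIVE line `(p, q) = (1, 0)` in normal form: `(1 + n₀)/2`. -/
lemma shift_pos (n₀ : ℤ) : (((1 : ℕ) : ℤ) - ((0 : ℕ) : ℤ) + n₀) / 2 = (1 + n₀) / 2 := by
  push_cast; ring_nf

/-- The `U(V)`-side shift of a NEGATIVE line `(p, q) = (0, 1)` in normal form: `(n₀ − 1)/2`. -/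
lemma shift_neg (n₀ : ℤ) : (((0 : ℕ) : ℤ) - ((1 : ℕ) : ℤ) + n₀) / 2 = (n₀ - 1) / 2 := by
  push_cast; ring_nf

/-- The parity condition `n₀ ≡ p + q` for the positive line, in normal form. -/
lemma parity_line (n₀ : ℤ) : (((1 : ℕ) : ℤ) + ((0 : ℕ) : ℤ) + n₀) % 2 = 0 ↔ (1 + n₀) % 2 = 0 := by
  push_cast; simp

/-- The parity condition `n₀ ≡ p + q` for the negative line, in normal form. -/
lemma parity_line' (n₀ : ℤ) : (((0 : ℕ) : ℤ) + ((1 : ℕ) : ℤ) + n₀) % 2 = 0 ↔ (1 + n₀) % 2 = 0 := by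
  push_cast; simp

/-! ### The vacuum pairs (all blocks empty): every signature -/

/-- The vacuum pair: `(μ, μ')` with all four blocks empty is in the correspondence for every
`(p, q)`, `(r, s)` and every admissible `(m₀, n₀)`: `μ = ((r−s+m₀)/2 on U(p); (s−r+m₀)/2 on U(q))`,
`μ' = ((p−q+n₀)/2 on U(r); (q−p+n₀)/2 on U(s))` — the K-types of the constant polynomial
(KK07's `Δ_{0000}`, row KK1 "the K_V-trivial vector"). -/
theorem correspond_vacuum (p q r s : ℕ) (m₀ n₀ : ℤ)
    (hm : ((r : ℤ) + s + m₀) % 2 = 0) (hn : ((p : ℤ) + q + n₀) % 2 = 0) :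
    Correspond p q r s m₀ n₀
      (List.replicate p (((r : ℤ) - s + m₀) / 2), List.replicate q (((s : ℤ) - r + m₀) / 2))
      (List.replicate r (((p : ℤ) - q + n₀) / 2), List.replicate s (((q : ℤ) - p + n₀) / 2)) :=
  ⟨hm, hn, [], [], [], [], by simp, by simp, by simp, by simp, by simp, by simp, by simp, by simp,
    by simp, by simp, by simp, by simp⟩

/-! ### A LINE against a space of signature `(r, s)`: the complete list of pairs -/

/-- **The positive line.**  `W` of signature `(1, 0)` (⟨w, w⟩ = +√−1 in IC1's basis), character
`z ↦ z^k` of `U(1)`, `V` of signature `(r, s)`.  The pairs of Lemma 7.8 are exactly: the vacuum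
(`k = (r−s+m₀)/2`, `μ' = det^{(1+n₀)/2} ⊠ det^{(n₀−1)/2}`); the `a`-family (`k = a + (r−s+m₀)/2`, `a > 0`,
needs `r ≥ 1`; `μ'` has `a` added to the FIRST `U(r)`-coordinate); the `b`-family (`k = b + (r−s+m₀)/2`,
`b < 0`, needs `s ≥ 1`; `b` added to the LAST `U(s)`-coordinate).  No `c`/`d` blocks (`q = 0`). -/
theorem correspond_posLine_iff (r s : ℕ) (m₀ n₀ k : ℤ) (μ' : List ℤ × List ℤ) :
    Correspond 1 0 r s m₀ n₀ ([k], []) μ' ↔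
      ((r : ℤ) + s + m₀) % 2 = 0 ∧ (1 + n₀) % 2 = 0 ∧
      ((k = ((r : ℤ) - s + m₀) / 2 ∧
          μ' = (List.replicate r ((1 + n₀) / 2), List.replicate s ((n₀ - 1) / 2))) ∨
       (∃ a : ℤ, 0 < a ∧ 1 ≤ r ∧ k = a + ((r : ℤ) - s + m₀) / 2 ∧
          μ' = ((a + (1 + n₀) / 2) :: List.replicate (r - 1) ((1 + n₀) / 2),
                List.replicate s ((n₀ - 1) / 2))) ∨
       (∃ b : ℤ, b < 0 ∧ 1 ≤ s ∧ k = b + ((r : ℤ) - s + m₀) / 2 ∧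
          μ' = (List.replicate r ((1 + n₀) / 2),
                List.replicate (s - 1) ((n₀ - 1) / 2) ++ [b + (n₀ - 1) / 2]))) := by
  obtain ⟨μ₁, μ₂⟩ := μ'
  constructor
  · rintro ⟨hm, hn, a, b, c, d, ha, hb, hc, hd, hab, hcd, had, hcb, h1, h2, h3, h4⟩
    rw [parity_line] at hn
    rw [shift_pos] at h3
    rw [shift_neg] at h4
    have hc0 : c = [] := List.eq_nil_of_length_eq_zero (by omega)
    have hd0 : d = [] := List.eq_nil_of_length_eq_zero (by omega)
    subst hc0 hd0
    simp only [List.length_nil, add_zero, zero_add] at hab had hcb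
    refine ⟨hm, hn, ?_⟩
    rcases eq_nil_or_singleton_of_length_le_one (show a.length ≤ 1 by omega) with rfl | ⟨x, rfl⟩
    · rcases eq_nil_or_singleton_of_length_le_one (show b.length ≤ 1 by omega) with rfl | ⟨y, rfl⟩
      · -- the vacuum
        left
        simp only [padded_nil_nil, List.replicate_one, List.cons.injEq, and_true] at h1 h3 h4
        exact ⟨h1, by rw [h3, h4]⟩
      · -- the b-family
        right; right
        simp only [List.length_singleton] at hcb
        simp only [padded, List.nil_append, List.length_nil, List.length_singleton, Nat.sub_zero,
          Nat.sub_self, List.replicate_zero, List.map_cons, List.map_nil, List.cons.injEq,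
          and_true] at h1
        rw [padded_nil_nil] at h3
        rw [padded_nil_singleton y s _ hcb] at h4
        exact ⟨y, (negAntitone_singleton y).1 hb, hcb, h1, Prod.ext h3 h4⟩
    · -- a = [x]: the a-family (b must be empty, x + y ≤ 1)
      simp only [List.length_singleton] at hab had
      have hb0 : b = [] := List.eq_nil_of_length_eq_zero (by omega)
      subst hb0
      right; left
      simp only [padded, List.length_singleton, List.length_nil, Nat.sub_self,
        List.replicate_zero, List.append_nil, List.map_cons, List.map_nil, List.cons.injEq,
        and_true] at h1
      rw [padded_singleton_nil x r _ (by omega)] at h3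
      rw [padded_nil_nil] at h4
      exact ⟨x, (posAntitone_singleton x).1 ha, by omega, h1, Prod.ext h3 h4⟩
  · rintro ⟨hm, hn, ⟨hk, hμ⟩ | ⟨a, ha, hr, hk, hμ⟩ | ⟨b, hb, hs, hk, hμ⟩⟩ <;>
      simp only [Prod.mk.injEq] at hμ <;> obtain ⟨rfl, rfl⟩ := hμ
    · exact ⟨hm, (parity_line n₀).2 hn, [], [], [], [], by simp, by simp, by simp, by simp,
        by simp, by simp, by simp, by simp, by simp [hk], by simp, by rw [shift_pos]; simp,
        by rw [shift_neg]; simp⟩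
    · exact ⟨hm, (parity_line n₀).2 hn, [a], [], [], [], by simpa using ha, by simp, by simp,
        by simp, by simp, by simp, by simpa using hr, by simp, by simp [padded, hk], by simp,
        by rw [shift_pos, padded_singleton_nil a r _ hr], by rw [shift_neg]; simp⟩
    · exact ⟨hm, (parity_line n₀).2 hn, [], [b], [], [], by simp, by simpa using hb, by simp,
        by simp, by simp, by simp, by simp, by simpa using hs, by simp [padded, hk], by simp,
        by rw [shift_pos]; simp, by rw [shift_neg, padded_nil_singleton b s _ hs]⟩

/-- **The negative line.**  `W` of signature `(0, 1)` (⟨w, w⟩ = −√−1), character `z ↦ z^k`,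
`V` of signature `(r, s)`: the vacuum (`k = (s−r+m₀)/2`, `μ' = det^{(n₀−1)/2} ⊠ det^{(1+n₀)/2}`); the
`c`-family (`k = c + (s−r+m₀)/2`, `c > 0`, needs `s ≥ 1`; `c` added to the FIRST `U(s)`-coordinate);
the `d`-family (`k = d + (s−r+m₀)/2`, `d < 0`, needs `r ≥ 1`; `d` added to the LAST `U(r)`-coordinate).
No `a`/`b` blocks (`p = 0`). -/
theorem correspond_negLine_iff (r s : ℕ) (m₀ n₀ k : ℤ) (μ' : List ℤ × List ℤ) :
    Correspond 0 1 r s m₀ n₀ ([], [k]) μ' ↔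
      ((r : ℤ) + s + m₀) % 2 = 0 ∧ (1 + n₀) % 2 = 0 ∧
      ((k = ((s : ℤ) - r + m₀) / 2 ∧
          μ' = (List.replicate r ((n₀ - 1) / 2), List.replicate s ((1 + n₀) / 2))) ∨
       (∃ c : ℤ, 0 < c ∧ 1 ≤ s ∧ k = c + ((s : ℤ) - r + m₀) / 2 ∧
          μ' = (List.replicate r ((n₀ - 1) / 2),
                (c + (1 + n₀) / 2) :: List.replicate (s - 1) ((1 + n₀) / 2))) ∨
       (∃ d : ℤ, d < 0 ∧ 1 ≤ r ∧ k = d + ((s : ℤ) - r + m₀) / 2 ∧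
          μ' = (List.replicate (r - 1) ((n₀ - 1) / 2) ++ [d + (n₀ - 1) / 2],
                List.replicate s ((1 + n₀) / 2)))) := by
  obtain ⟨μ₁, μ₂⟩ := μ'
  constructor
  · rintro ⟨hm, hn, a, b, c, d, ha, hb, hc, hd, hab, hcd, had, hcb, h1, h2, h3, h4⟩
    rw [parity_line'] at hn
    rw [shift_neg] at h3
    rw [shift_pos] at h4
    have ha0 : a = [] := List.eq_nil_of_length_eq_zero (by omega)
    have hb0 : b = [] := List.eq_nil_of_length_eq_zero (by omega)
    subst ha0 hb0
    simp only [List.length_nil, add_zero, zero_add] at hcd had hcb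
    refine ⟨hm, hn, ?_⟩
    rcases eq_nil_or_singleton_of_length_le_one (show c.length ≤ 1 by omega) with rfl | ⟨x, rfl⟩
    · rcases eq_nil_or_singleton_of_length_le_one (show d.length ≤ 1 by omega) with rfl | ⟨y, rfl⟩
      · -- the vacuum
        left
        simp only [padded_nil_nil, List.replicate_one, List.cons.injEq, and_true] at h2 h3 h4
        exact ⟨h2, by rw [h3, h4]⟩
      · -- the d-family
        right; right
        simp only [List.length_singleton] at had
        simp only [padded, List.nil_append, List.length_nil, List.length_singleton, Nat.sub_zero,
          Nat.sub_self, List.replicate_zero, List.map_cons, List.map_nil, List.cons.injEq,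
          and_true] at h2
        rw [padded_nil_singleton y r _ had] at h3
        rw [padded_nil_nil] at h4
        exact ⟨y, (negAntitone_singleton y).1 hd, had, h2, Prod.ext h3 h4⟩
    · -- c = [x]: the c-family (d must be empty)
      simp only [List.length_singleton] at hcd hcb
      have hd0 : d = [] := List.eq_nil_of_length_eq_zero (by omega)
      subst hd0
      right; left
      simp only [padded, List.length_singleton, List.length_nil, Nat.sub_self,
        List.replicate_zero, List.append_nil, List.map_cons, List.map_nil, List.cons.injEq,
        and_true] at h2
      rw [padded_nil_nil] at h3
      rw [padded_singleton_nil x s _ (by omega)] at h4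
      exact ⟨x, (posAntitone_singleton x).1 hc, by omega, h2, Prod.ext h3 h4⟩
  · rintro ⟨hm, hn, ⟨hk, hμ⟩ | ⟨c, hc, hs, hk, hμ⟩ | ⟨d, hd, hr, hk, hμ⟩⟩ <;>
      simp only [Prod.mk.injEq] at hμ <;> obtain ⟨rfl, rfl⟩ := hμ
    · exact ⟨hm, (parity_line' n₀).2 hn, [], [], [], [], by simp, by simp, by simp, by simp,
        by simp, by simp, by simp, by simp, by simp, by simp [hk], by rw [shift_neg]; simp,
        by rw [shift_pos]; simp⟩
    · exact ⟨hm, (parity_line' n₀).2 hn, [], [], [c], [], by simp, by simp, by simpa using hc,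
        by simp, by simp, by simp, by simp, by simpa using hs, by simp, by simp [padded, hk],
        by rw [shift_neg]; simp, by rw [shift_pos, padded_singleton_nil c s _ hs]⟩
    · exact ⟨hm, (parity_line' n₀).2 hn, [], [], [], [d], by simp, by simp, by simp,
        by simpa using hd, by simp, by simp, by simpa using hr, by simp, by simp,
        by simp [padded, hk], by rw [shift_neg, padded_nil_singleton d r _ hr],
        by rw [shift_pos]; simp⟩

end HodgeRepro.Lit2.KType
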